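import Literature.MathematicalPhysics.QuantumManyBody.JelliumBoxDecoupling
import HarnessLib

/-!
# Geometry of the small boxes: positions, interior boxes, and the background terms

Topic `Literature/MathematicalPhysics/QuantumManyBody` (the charged Bose gas, `JelliumBoseGas.foldyLaw`;
groundwork for [LiebSolovej2001, Lemma 3.3] "reduction to one small box"). In the continuous
sliding average the small box is `Q_z = z + Λ_ℓ`, `z ∈ ℝ³`; relative to the big box `Λ_L = (0,L)³`
the positions fall in three kinds [LiebSolovej2001, p. 9]: `Q_z ∩ Λ_L = ∅` (no background, no
particles), `Q_z ⊆ Λ_L` ("second kind": the background seen in the box is the full smeared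
background), and the boundary boxes ("third kind": part of the background is missing). This file
records the elementary facts used to handle them:

* positions: if some `x ∈ Λ_L` has `x - z ∈ Λ_ℓ` then `z ∈ (-ℓ, L)³` (`mem_Ioo_of_sub_mem_box`);
  if `z ∈ [0, L-ℓ]³` then `Q_z ⊆ Λ_L` (`mem_box_of_sub_mem_box`); volumes `(L+ℓ)³`, `(L-ℓ)³`;
* the cutoff at scale `ℓ`: `χ(x/ℓ) = 0` off `Λ_ℓ` when `χ = 0` off `Λ_1`;
* background–background term: `BB_Λ(z) = ∬_{Λ×Λ} θ(x-z)Y(x-y)θ(y-z) ≤ 2·(½∬θYθ)` always, with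
  equality for interior boxes (`setIntegral_boxBB_le`, `setIntegral_boxBB_eq`), and
  `½∬θYθ ≤ 3π M² ℓ⁵` for `0 ≤ θ ≤ M` supported in `Λ_ℓ` (`boxBackgroundSelfEnergy_le`) — the
  "`const ρ²ℓ⁵`" of [LiebSolovej2001, p. 9];
* particle–background term: restricting the background to `Λ_L` only decreases it,
  `∑ᵢ ∫_Λ θ(xᵢ-z)Y(xᵢ-y)θ(y-z)dy ≤ ∑ᵢ θ(xᵢ-z)U(xᵢ-z)` (`sum_setIntegral_pb_le_boxOneBody`) —
  "artificially adding the missing background … the second term can only decrease".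

## References

* [LiebSolovej2001] E. H. Lieb, J. P. Solovej, Commun. Math. Phys. 217 (2001) 127–163, p. 9
  (before Lemma 3.3) (arXiv:cond-mat/0007425).
-/

noncomputable section

open MeasureTheory Set Filter Real
open scoped ENNReal NNReal Topology

namespace Literature.MathematicalPhysics.QuantumManyBody.JelliumBoseGas

open BoseGas Coulomb

/-! ### Positions of the small box relative to the big box -/

section Positions

variable {L ℓ : ℝ}

/-- If a point of `Λ_L` lies in `z + Λ_ℓ` then `z ∈ (-ℓ, L)³`. [cite: LiebSolovej2001, p. 9] -/
theorem mem_Ioo_of_sub_mem_box {x z : Space} (hx : x ∈ box L) (hxz : x - z ∈ box ℓ) (k : Fin 3) :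
    z k ∈ Set.Ioo (-ℓ) L := by
  have h1 := hx k
  have h2 := hxz k
  simp only [PiLp.sub_apply, Set.mem_Ioo] at h1 h2 ⊢
  constructor <;> linarith [h1.1, h1.2, h2.1, h2.2]

/-- If `z ∈ [0, L-ℓ]³` then `z + Λ_ℓ ⊆ Λ_L`: every `x` with `x - z ∈ Λ_ℓ` lies in `Λ_L`
(boxes "of the second kind"). [cite: LiebSolovej2001, p. 9] -/
theorem mem_box_of_sub_mem_box {z : Space} (hz : ∀ k, z k ∈ Set.Icc 0 (L - ℓ)) {x : Space}
    (hxz : x - z ∈ box ℓ) : x ∈ box L := by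
  intro k
  have h1 := hz k
  have h2 := hxz k
  simp only [PiLp.sub_apply, Set.mem_Ioo, Set.mem_Icc] at h1 h2 ⊢
  constructor <;> linarith [h1.1, h1.2, h2.1, h2.2]

/-- The region of relevant positions `(-ℓ, L)³` is measurable. [folklore] -/
theorem measurableSet_zRegion (L ℓ : ℝ) : MeasurableSet {z : Space | ∀ k, z k ∈ Set.Ioo (-ℓ) L} := by
  have h : {z : Space | ∀ k, z k ∈ Set.Ioo (-ℓ) L} = ⋂ k, (fun z : Space => z k) ⁻¹' Set.Ioo (-ℓ) L := by
    ext z; simp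
  rw [h]
  exact MeasurableSet.iInter fun k => measurableSet_Ioo.preimage (by fun_prop)

/-- The region of interior positions `[0, L-ℓ]³` is measurable. [folklore] -/
theorem measurableSet_zInterior (L ℓ : ℝ) :
    MeasurableSet {z : Space | ∀ k, z k ∈ Set.Icc 0 (L - ℓ)} := by
  have h : {z : Space | ∀ k, z k ∈ Set.Icc 0 (L - ℓ)} =
      ⋂ k, (fun z : Space => z k) ⁻¹' Set.Icc 0 (L - ℓ) := by
    ext z; simp
  rw [h]
  exact MeasurableSet.iInter fun k => measurableSet_Icc.preimage (by fun_prop)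

/-- `|(-ℓ, L)³| = (L + ℓ)³`. [cite: LiebSolovej2001, p. 9 ("(1 + L/ℓ)³")] -/
theorem volume_zRegion (L ℓ : ℝ) :
    volume {z : Space | ∀ k, z k ∈ Set.Ioo (-ℓ) L} = ENNReal.ofReal (L + ℓ) ^ 3 := by
  have h : {z : Space | ∀ k, z k ∈ Set.Ioo (-ℓ) L} =
      (@WithLp.ofLp 2 (Fin 3 → ℝ)) ⁻¹' (Set.univ.pi fun _ => Set.Ioo (-ℓ) L) := by
    ext x; simp only [Set.mem_setOf_eq, Set.mem_preimage, Set.mem_univ_pi]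
  rw [h, (PiLp.volume_preserving_ofLp (Fin 3)).measure_preimage
    (MeasurableSet.univ_pi fun _ => measurableSet_Ioo).nullMeasurableSet, volume_pi_pi]
  simp only [Real.volume_Ioo, Finset.prod_const, Finset.card_univ, Fintype.card_fin]
  congr 1
  congr 1
  ring

/-- `|[0, L-ℓ]³| = (L - ℓ)³` for `ℓ ≤ L`. [cite: LiebSolovej2001, p. 9] -/
theorem volume_zInterior (L ℓ : ℝ) :
    volume {z : Space | ∀ k, z k ∈ Set.Icc 0 (L - ℓ)} = ENNReal.ofReal (L - ℓ) ^ 3 := by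
  have h : {z : Space | ∀ k, z k ∈ Set.Icc 0 (L - ℓ)} =
      (@WithLp.ofLp 2 (Fin 3 → ℝ)) ⁻¹' (Set.univ.pi fun _ => Set.Icc 0 (L - ℓ)) := by
    ext x; simp only [Set.mem_setOf_eq, Set.mem_preimage, Set.mem_univ_pi]
  rw [h, (PiLp.volume_preserving_ofLp (Fin 3)).measure_preimage
    (MeasurableSet.univ_pi fun _ => measurableSet_Icc).nullMeasurableSet, volume_pi_pi]
  simp only [Real.volume_Icc, Finset.prod_const, Finset.card_univ, Fintype.card_fin, sub_zero]

/-- The interior positions lie in the region of relevant positions (`ℓ > 0`). [folklore] -/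
theorem zInterior_subset_zRegion (hℓ : 0 < ℓ) :
    {z : Space | ∀ k, z k ∈ Set.Icc 0 (L - ℓ)} ⊆ {z : Space | ∀ k, z k ∈ Set.Ioo (-ℓ) L} := by
  intro z hz k
  have h := hz k
  simp only [Set.mem_Icc, Set.mem_Ioo] at h ⊢
  constructor <;> linarith [h.1, h.2]

/-- The boundary positions have volume `(L+ℓ)³ - (L-ℓ)³`. [cite: LiebSolovej2001, p. 9
("the number of boxes of the third kind is bounded above by const (L/ℓ)²")] -/
theorem volume_zRegion_diff_zInterior (hℓ : 0 < ℓ) :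
    volume ({z : Space | ∀ k, z k ∈ Set.Ioo (-ℓ) L} \ {z : Space | ∀ k, z k ∈ Set.Icc 0 (L - ℓ)}) =
      ENNReal.ofReal (L + ℓ) ^ 3 - ENNReal.ofReal (L - ℓ) ^ 3 := by
  rw [measure_sdiff (zInterior_subset_zRegion hℓ) (measurableSet_zInterior L ℓ).nullMeasurableSet
    (by rw [volume_zInterior]; exact ENNReal.pow_ne_top ENNReal.ofReal_ne_top),
    volume_zRegion, volume_zInterior]

end Positions

/-! ### The cutoff at scale `ℓ` -/

section Cutoff

variable {χ : Space → ℝ} {ℓ : ℝ}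

/-- `x ∈ Λ_ℓ ↔ x/ℓ ∈ Λ_1` for `ℓ > 0`. [folklore] -/
theorem inv_smul_mem_box_iff (hℓ : 0 < ℓ) (x : Space) : ℓ⁻¹ • x ∈ box 1 ↔ x ∈ box ℓ := by
  simp only [box, Set.mem_setOf_eq, PiLp.smul_apply, smul_eq_mul, Set.mem_Ioo]
  refine forall_congr' fun k => ?_
  rw [← div_eq_inv_mul, div_pos_iff_of_pos_right hℓ, div_lt_one hℓ]

/-- If `χ = 0` off `Λ_1` then `χ(·/ℓ) = 0` off `Λ_ℓ` (`ℓ > 0`). [folklore] -/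
theorem cutoff_eq_zero_of_not_mem_box (hχ0 : ∀ x, x ∉ box 1 → χ x = 0) (hℓ : 0 < ℓ) (x : Space)
    (hx : x ∉ box ℓ) : χ (ℓ⁻¹ • x) = 0 :=
  hχ0 _ fun h => hx ((inv_smul_mem_box_iff hℓ x).1 h)

end Cutoff

/-! ### The background–background term of a box -/

section BB

variable {θ : Space → ℝ} {ν : ℝ}

/-- `(x, y) ↦ θ(x) θ(y) Y_ν(x - y)` is integrable on `ℝ³ × ℝ³` for continuous compactly supported
`θ` and `ν > 0`. [folklore] -/
theorem integrable_prod_cutoff_mul_yukawa (hθ : Continuous θ) (hsupp : HasCompactSupport θ)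
    (hν : 0 < ν) :
    Integrable (fun q : Space × Space => θ q.1 * yukawa ν (q.1 - q.2) * θ q.2)
      (volume.prod volume) := by
  have hθi : Integrable θ := hθ.integrable_of_hasCompactSupport hsupp
  have hY := integrable_yukawa' hν
  have h1 : Integrable (fun q : Space × Space => θ q.2 * yukawa ν (q.1 - q.2)) (volume.prod volume) := by
    have := hθi.convolution_integrand (ContinuousLinearMap.mul ℝ ℝ) hY
    simpa only [ContinuousLinearMap.mul_apply'] using this
  obtain ⟨M, hMr⟩ := hθ.norm.bddAbove_range_of_hasCompactSupport hsupp.norm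
  have hm1 : Measurable fun q : Space × Space => θ q.1 := hθ.measurable.comp measurable_fst
  have h2 := h1.bdd_mul (c := M) hm1.aestronglyMeasurable
    (Eventually.of_forall fun q => hMr ⟨q.1, rfl⟩)
  refine h2.congr (Eventually.of_forall fun q => ?_)
  simp only
  ring

/-- `∬ θ(x) Y(x-y) θ(y) dx dy = 2 · (½ ∫ θ U) = ∫ θ U`, `U(x) = ∫ θ(y)Y(x-y)dy` (Fubini).
[cite: LiebSolovej2001, (3.9)] -/
theorem integral_prod_cutoff_mul_yukawa (hθ : Continuous θ) (hsupp : HasCompactSupport θ)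
    (hν : 0 < ν) :
    ∫ q : Space × Space, θ q.1 * yukawa ν (q.1 - q.2) * θ q.2 ∂(volume.prod volume) =
      2 * boxBackgroundSelfEnergy θ ν := by
  rw [integral_prod _ (integrable_prod_cutoff_mul_yukawa hθ hsupp hν), boxBackgroundSelfEnergy]
  rw [show (2 : ℝ) * (1 / 2 * ∫ x, θ x * smearedBackground θ ν x) =
    ∫ x, θ x * smearedBackground θ ν x by ring]
  refine integral_congr_ae (Eventually.of_forall fun x => ?_)
  simp only [smearedBackground]
  rw [← integral_const_mul]
  refine integral_congr_ae (Eventually.of_forall fun y => ?_)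
  ring

/-- Translating both variables by `z`:
`∬ θ(x-z) Y(x-y) θ(y-z) = ∬ θ(x) Y(x-y) θ(y)`. [folklore] -/
theorem integral_prod_cutoff_sub (θ : Space → ℝ) (ν : ℝ) (z : Space) :
    ∫ q : Space × Space, θ (q.1 - z) * yukawa ν (q.1 - q.2) * θ (q.2 - z) ∂(volume.prod volume) =
      ∫ q : Space × Space, θ q.1 * yukawa ν (q.1 - q.2) * θ q.2 ∂(volume.prod volume) := by
  have h := integral_sub_right_eq_self (μ := (volume : Measure Space).prod volume)
    (fun q : Space × Space => θ q.1 * yukawa ν (q.1 - q.2) * θ q.2) (z, z)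
  rw [← h]
  refine integral_congr_ae (Eventually.of_forall fun q => ?_)
  simp only [Prod.fst_sub, Prod.snd_sub, sub_sub_sub_cancel_right]

/-- **`BB_Λ(z) ≤ ∬w`**: `∬_{Λ×Λ} θ(x-z)Y(x-y)θ(y-z) ≤ 2 · (½∬ θYθ)` for `θ ≥ 0` continuous with
compact support. [cite: LiebSolovej2001, p. 9] -/
theorem setIntegral_boxBB_le (hθ : Continuous θ) (hsupp : HasCompactSupport θ)
    (hθnn : ∀ x, 0 ≤ θ x) (hν : 0 < ν) (L : ℝ) (z : Space) :
    ∫ q in box L ×ˢ box L, θ (q.1 - z) * yukawa ν (q.1 - q.2) * θ (q.2 - z) ∂(volume.prod volume) ≤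
      2 * boxBackgroundSelfEnergy θ ν := by
  have hint : Integrable (fun q : Space × Space => θ (q.1 - z) * yukawa ν (q.1 - q.2) * θ (q.2 - z))
      (volume.prod volume) := by
    have h := (integrable_prod_cutoff_mul_yukawa hθ hsupp hν).comp_sub_right (z, z)
    refine h.congr (Eventually.of_forall fun q => ?_)
    simp only [Prod.fst_sub, Prod.snd_sub, sub_sub_sub_cancel_right]
  calc ∫ q in box L ×ˢ box L, θ (q.1 - z) * yukawa ν (q.1 - q.2) * θ (q.2 - z) ∂(volume.prod volume)
      ≤ ∫ q, θ (q.1 - z) * yukawa ν (q.1 - q.2) * θ (q.2 - z) ∂(volume.prod volume) :=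
        setIntegral_le_integral hint (Eventually.of_forall fun q =>
          mul_nonneg (mul_nonneg (hθnn _) (yukawa_nonneg ν _)) (hθnn _))
    _ = 2 * boxBackgroundSelfEnergy θ ν := by
        rw [integral_prod_cutoff_sub, integral_prod_cutoff_mul_yukawa hθ hsupp hν]

/-- **`BB_Λ(z) = ∬w` for interior boxes**: if `θ = 0` off `Λ_ℓ` and `z ∈ [0, L-ℓ]³` (so
`z + Λ_ℓ ⊆ Λ_L`) then `∬_{Λ×Λ} θ(x-z)Y(x-y)θ(y-z) = 2 · (½∬θYθ)`. [cite: LiebSolovej2001, p. 9] -/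
theorem setIntegral_boxBB_eq (hθ : Continuous θ) (hsupp : HasCompactSupport θ) {ℓ : ℝ}
    (hθ0 : ∀ x, x ∉ box ℓ → θ x = 0) (hν : 0 < ν) {L : ℝ} {z : Space}
    (hz : ∀ k, z k ∈ Set.Icc 0 (L - ℓ)) :
    ∫ q in box L ×ˢ box L, θ (q.1 - z) * yukawa ν (q.1 - q.2) * θ (q.2 - z) ∂(volume.prod volume) =
      2 * boxBackgroundSelfEnergy θ ν := by
  rw [setIntegral_eq_integral_of_forall_compl_eq_zero fun q hq => ?_, integral_prod_cutoff_sub,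
    integral_prod_cutoff_mul_yukawa hθ hsupp hν]
  -- off `Λ × Λ` the integrand vanishes
  simp only [Set.mem_prod, not_and_or] at hq
  rcases hq with h1 | h2
  · rw [hθ0 _ (fun h => h1 (mem_box_of_sub_mem_box hz h)), zero_mul, zero_mul]
  · rw [hθ0 _ (fun h => h2 (mem_box_of_sub_mem_box hz h)), mul_zero]

/-- The smeared background of a cutoff `0 ≤ θ ≤ M` supported in `Λ_ℓ` is at most `M V_{Λ_ℓ}`:
`U(x) ≤ M ∫_{Λ_ℓ} |x - y|⁻¹ dy` (`ν ≥ 0`). [folklore] -/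
theorem smearedBackground_le_backgroundPotential (hθnn : ∀ x, 0 ≤ θ x) {M : ℝ}
    (hM : ∀ x, θ x ≤ M) {ℓ : ℝ} (hθ0 : ∀ x, x ∉ box ℓ → θ x = 0) (hν : 0 ≤ ν) (x : Space) :
    smearedBackground θ ν x ≤ M * backgroundPotential ℓ x := by
  have hM0 : 0 ≤ M := (hθnn 0).trans (hM 0)
  have hpt : ∀ y, θ y * yukawa ν (x - y) ≤ (box ℓ).indicator (fun y => M * ‖x - y‖⁻¹) y := by
    intro y
    by_cases hy : y ∈ box ℓ
    · rw [indicator_of_mem hy]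
      exact mul_le_mul (hM y) (yukawa_le_inv_norm hν _) (yukawa_nonneg ν _) hM0
    · rw [indicator_of_notMem hy, hθ0 y hy, zero_mul]
  have hint : Integrable ((box ℓ).indicator fun y => M * ‖x - y‖⁻¹) := by
    rw [integrable_indicator_iff (measurableSet_box ℓ)]
    exact (integrableOn_inv_norm_sub_box x ℓ).const_mul M
  calc smearedBackground θ ν x ≤ ∫ y, (box ℓ).indicator (fun y => M * ‖x - y‖⁻¹) y :=
        integral_mono_of_nonneg (Eventually.of_forall fun y =>
          mul_nonneg (hθnn y) (yukawa_nonneg ν _)) hint (Eventually.of_forall hpt)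
    _ = M * backgroundPotential ℓ x := by
        rw [integral_indicator (measurableSet_box ℓ), integral_const_mul, backgroundPotential]

/-- **The background self-energy of a small box is `O(ℓ⁵)`**: for `0 ≤ θ ≤ M` supported in
`Λ_ℓ` (`ℓ ≥ 0`, `ν ≥ 0`), `½∬ θ(x)Y_ν(x-y)θ(y) ≤ 3π M² ℓ⁵` (`U ≤ M V_{Λ_ℓ} ≤ 6πMℓ²` on `Λ_ℓ`,
`|Λ_ℓ| = ℓ³`). [cite: LiebSolovej2001, p. 9 ("≤ const ρ²ℓ⁵")] -/
theorem boxBackgroundSelfEnergy_le (hθnn : ∀ x, 0 ≤ θ x) {M : ℝ} (hM : ∀ x, θ x ≤ M) {ℓ : ℝ}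
    (hℓ : 0 ≤ ℓ) (hθ0 : ∀ x, x ∉ box ℓ → θ x = 0) (hν : 0 ≤ ν) :
    boxBackgroundSelfEnergy θ ν ≤ 3 * π * M ^ 2 * ℓ ^ 5 := by
  have hM0 : 0 ≤ M := (hθnn 0).trans (hM 0)
  have hpt : ∀ x, θ x * smearedBackground θ ν x ≤
      (box ℓ).indicator (fun _ => M * (M * (6 * π * ℓ ^ 2))) x := by
    intro x
    by_cases hx : x ∈ box ℓ
    · rw [indicator_of_mem hx]
      refine mul_le_mul (hM x) ((smearedBackground_le_backgroundPotential hθnn hM hθ0 hν x).trans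
        (mul_le_mul_of_nonneg_left (backgroundPotential_le hx) hM0))
        (smearedBackground_nonneg hθnn ν x) hM0
    · rw [indicator_of_notMem hx, hθ0 x hx, zero_mul]
  have hint : Integrable ((box ℓ).indicator fun _ : Space => M * (M * (6 * π * ℓ ^ 2))) := by
    rw [integrable_indicator_iff (measurableSet_box ℓ)]
    exact integrableOn_const (volume_box_lt_top ℓ).ne
  have h1 : ∫ x, θ x * smearedBackground θ ν x ≤ M * (M * (6 * π * ℓ ^ 2)) * ℓ ^ 3 := by
    calc ∫ x, θ x * smearedBackground θ ν x
        ≤ ∫ x, (box ℓ).indicator (fun _ => M * (M * (6 * π * ℓ ^ 2))) x :=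
          integral_mono_of_nonneg (Eventually.of_forall fun x =>
            mul_nonneg (hθnn x) (smearedBackground_nonneg hθnn ν x)) hint (Eventually.of_forall hpt)
      _ = M * (M * (6 * π * ℓ ^ 2)) * ℓ ^ 3 := by
          rw [integral_indicator (measurableSet_box ℓ), setIntegral_const, smul_eq_mul, measureReal_def,
            volume_box, ENNReal.toReal_pow, ENNReal.toReal_ofReal hℓ, mul_comm]
  rw [boxBackgroundSelfEnergy]
  nlinarith [h1, Real.pi_pos, sq_nonneg M, pow_nonneg hℓ 5]

end BB

/-! ### The particle–background term: restricting the background only decreases it -/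

section PB

variable {θ : Space → ℝ} {ν : ℝ}

/-- `y ↦ Y_ν(x - y) θ(y - z)` is integrable for bounded measurable `θ` and `ν > 0`. [folklore] -/
theorem integrable_yukawa_sub_mul (hθm : Measurable θ) {M : ℝ} (hM : ∀ y, ‖θ y‖ ≤ M) (hν : 0 < ν)
    (x z : Space) : Integrable fun y : Space => yukawa ν (x - y) * θ (y - z) := by
  have hY : Integrable fun y : Space => yukawa ν (x - y) := (integrable_yukawa' hν).comp_sub_left x
  exact hY.mul_bdd (c := M) (hθm.comp (measurable_id.sub_const z)).aestronglyMeasurable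
    (Eventually.of_forall fun y => hM _)

/-- `∫ Y_ν(x - y) θ(y - z) dy = U(x - z)`, `U = smearedBackground θ ν` (translate `y ↦ y + z`).
[folklore] -/
theorem integral_yukawa_sub_mul (θ : Space → ℝ) (ν : ℝ) (x z : Space) :
    ∫ y, yukawa ν (x - y) * θ (y - z) = smearedBackground θ ν (x - z) := by
  rw [smearedBackground, ← integral_sub_right_eq_self (μ := (volume : Measure Space))
    (fun y' : Space => θ y' * yukawa ν (x - z - y')) z]
  refine integral_congr_ae (Eventually.of_forall fun y => ?_)
  simp only [sub_sub_sub_cancel_right]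
  ring

/-- **Restricting the background to `Λ_L` only decreases the particle–background term**
[LiebSolovej2001, p. 9 ("the second can only decrease")]: for `θ ≥ 0` bounded measurable, `ν > 0`,
`∫_{Λ_L} θ(x-z)Y(x-y)θ(y-z)dy ≤ θ(x-z) U(x-z)`. [cite: LiebSolovej2001, p. 9] -/
theorem setIntegral_pb_le (hθm : Measurable θ) (hθnn : ∀ x, 0 ≤ θ x) {M : ℝ} (hM : ∀ x, θ x ≤ M)
    (hν : 0 < ν) (L : ℝ) (x z : Space) :
    ∫ y in box L, θ (x - z) * yukawa ν (x - y) * θ (y - z) ≤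
      θ (x - z) * smearedBackground θ ν (x - z) := by
  have hMn : ∀ y, ‖θ y‖ ≤ M := fun y => by
    rw [Real.norm_eq_abs, abs_of_nonneg (hθnn y)]; exact hM y
  have hint := integrable_yukawa_sub_mul hθm hMn hν x z
  have e : ∀ y, θ (x - z) * yukawa ν (x - y) * θ (y - z) = θ (x - z) * (yukawa ν (x - y) * θ (y - z)) :=
    fun y => by ring
  simp_rw [e]
  rw [integral_const_mul, ← integral_yukawa_sub_mul θ ν x z]
  refine mul_le_mul_of_nonneg_left ?_ (hθnn _)
  exact setIntegral_le_integral hint (Eventually.of_forall fun y =>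
    mul_nonneg (yukawa_nonneg ν _) (hθnn _))

/-- The same summed over the particles: `PB_Λ(X, z) ≤ ∑ⱼ θ(xⱼ-z)U(xⱼ-z) = boxOneBody θ ν (X - z)`.
[cite: LiebSolovej2001, p. 9] -/
theorem sum_setIntegral_pb_le_boxOneBody (hθm : Measurable θ) (hθnn : ∀ x, 0 ≤ θ x) {M : ℝ}
    (hM : ∀ x, θ x ≤ M) (hν : 0 < ν) (L : ℝ) {N : ℕ} (X : Config N) (z : Space) :
    ∑ i, ∫ y in box L, θ (X i - z) * yukawa ν (X i - y) * θ (y - z) ≤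
      ∑ i, θ (X i - z) * smearedBackground θ ν (X i - z) :=
  Finset.sum_le_sum fun i _ => setIntegral_pb_le hθm hθnn hM hν L (X i) z

end PB

end Literature.MathematicalPhysics.QuantumManyBody.JelliumBoseGas
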